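import Mathlib
import Summits.ValiantsHypothesis.ValiantsHypothesis.Theses.FreeSubtorus
import Summits.ValiantsHypothesis.ValiantsHypothesis.Cruxes.OrbitDimensionBound.Lines.DepthLadder
import Literature.Computability.AlgebraicComplexity.EquivariantDC
import Literature.Computability.AlgebraicComplexity.DetReprEquivalent
import Literature.Computability.AlgebraicComplexity.StandardFamiliesProofs
import Summits.ValiantsHypothesis.ValiantsHypothesis.Theorems.FreeSubtorusOrbitDimensionBoundStubPolystableModel
import Summits.ValiantsHypothesis.ValiantsHypothesis.Theorems.FreeSubtorusOrbitDimensionBoundStubJordanHolder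

/-!
# Line `filtered_covering` — skeleton for the rung `Depth.FilteredShadow` (degeneration-depth dial, Jordan–Hölder transport)

Crux advanced: `OrbitDimensionBound` (stmt-ValiantsHypothesis-16133) of `route-ValiantsHypothesis-FreeSubtorus`; floor
`SubtorusCovering` (PROVED, `subtorusCovering_proof`); rung `Depth.FilteredShadow` / numeric `Depth.FilteredCovering =
DepthCovering 1`, top `Depth.PolystableCovering = DepthCovering ⊤` (`Lines/DepthLadder.lean`, sorry-free: `q = 0` IS the floor
(`depthCovering_zero_iff`), `S → DepthShadow q` PROVED for every `q`, determinant constancy along degenerations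
(`det_weightTruncate`) and functoriality of degenerations under substitution (`IsDegeneration.linSubstEntries`,
`IsDegenerationClosed.linSubstEntries`) PROVED).

THE LINE (why the floor's proof stops and what replaces the failing step).  `subtorusCovering_proof` grades `ℂ^m` by an actual
lift pair `(g, h) ∈ GL_m²` of a generic torus element (`stub_torusBound`); under the rung's hypothesis there is no such pair —
`A(γ·x)` and `A(x)` are only known to have a COMMON DEGENERATION.  New object: the POLYSTABLE MODEL `P = gr_JH(A)` of the pencil
`A` (Jordan–Hölder in King's abelian, finite-length category of `θ`-semistable representations of the generalised Kronecker quiver,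
`θ = (-1, 1)`; an affine representation of `per_n` has `det ≢ 0`, hence is `θ`-semistable, and its one-parameter degenerations
`IsDegeneration ⊤ A B` are exactly the associated gradeds of filtrations by equal-dimension sub-pencils).  Two stubs:

* `stub_polystableModel` (JH EXISTENCE + semisimple ⇒ degeneration-closed): every affine representation `A` of `per_n` has a
  degeneration `P` (same size `m`) which is again an affine representation of `per_n` and whose gauge orbit is closed under
  degeneration;
* `stub_jordanHolder` (JH UNIQUENESS as TRANSPORT): if `A` and `A'` have a common degeneration, then any degeneration-closed
  degenerations `P` of `A` and `P'` of `A'` are gauge equivalent (`P ≅ ss(A) ≅ ss(B) ≅ ss(A') ≅ P'`).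

Composition (kernel-checked below): for `γ ∈ T_Λ`-generators, `γ ⋆ P` is a degeneration-closed degeneration of `γ ⋆ A`
(functoriality, PROVED in the ladder), so `stub_jordanHolder` with `A' = γ ⋆ A`, `P' = γ ⋆ P` gives an EXACT constant lift
`γ ⋆ P = g · P · h⁻¹`; the floor `DepthCovering 0` (= `SubtorusCovering`, by name) applied to `P` (same `m`, same `Λ`) gives
`C(n,⌊n/2⌋) ≤ m · 2^r`.  This proves the WHOLE dial (`PolystableCovering`, hence `FilteredCovering`, hence the filed rung
`FilteredShadow`).  STATUS 2026-08-28: both `stub_*` are CLOSED BY NAME by landed `Theorems/` helpers (stub 1: p618817 via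
`…StubPolystableModel`; stub 2: p638570 `…StubJordanHolder`) — this workfile is sorry-free; the rung `FilteredShadow` (and the
whole dial `PolystableCovering`) is a theorem; the CRUX `OrbitDimensionBound` (stmt-16133), the route `FreeSubtorus` and the
summit stay OPEN — `summit_of_stubs*` remain CONDITIONAL on the symmetrisation hypothesis `OrbitDepthBound q`.

Informal sources: [cite: King1994, Prop. 3.1, Thm. 4.1] (θ-stability, the abelian category of semistables, S-equivalence =
isomorphic JH gradeds = same point of the moduli space); [cite: KempfNess1979] and [cite: MumfordFogartyKirwan1994, Ch. 2 §1]
(closed orbits and one-parameter limits); [cite: LandsbergRessayre2017, Def. 1.3, Thm. 2.8, Question 2.2] (exact lifts, the floor).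
-/

open Matrix MvPolynomial
open Literature.Computability.AlgebraicComplexity
open Summit.ValiantsHypothesis.ValiantsHypothesis.Cruxes.OrbitDimensionBound.Gauge
open Summit.ValiantsHypothesis.ValiantsHypothesis.Cruxes.OrbitDimensionBound.Depth

set_option linter.dupNamespace false

noncomputable section

namespace Summit.ValiantsHypothesis.ValiantsHypothesis.Cruxes.OrbitDimensionBound.Depth.Line

/-! ## §1 The two stubs (statements as named `Prop`s, then the sorried theorems) -/

/-- **Stub 1 — polystable model (Jordan–Hölder existence; semisimple ⇒ degeneration-closed).**  Every affine determinantal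
representation `A` of `per_n` of size `m` has a one-parameter degeneration `P` (same size) which is again an affine determinantal
representation of `per_n` (entries stay affine: `IsDegeneration.totalDegree_le`; `det` changes by a unit: `IsDegeneration.det_eq`,
renormalised into the gauge) and whose constant gauge orbit is CLOSED UNDER DEGENERATION (`IsDegenerationClosed P`): `P` is the
matrix of the Jordan–Hölder graded `gr_JH(A)` in adapted bases — a direct sum of `θ`-stable pencils, every equal-dimension
sub-pencil of which splits off.  Size L (the finite-length abelian category of `θ`-semistable pencils, `θ = (-1,1)`, has to be set
up: sub-pencils `(V', W')`, `A(V') ⊆ W'`, `dim V' = dim W'`; Mathlib has `JordanHolderLattice` / `CompositionSeries`).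
[cite: King1994, Prop. 3.1, Thm. 4.1] [cite: KempfNess1979] -/
def Stmt.stub_polystableModel : Prop :=
  ∀ (n m : ℕ) (A : Matrix (Fin m) (Fin m) (MvPolynomial (Fin n × Fin n) ℂ)),
    IsAffineDetRepr (perPoly (Fin n) ℂ) A →
    ∃ P : Matrix (Fin m) (Fin m) (MvPolynomial (Fin n × Fin n) ℂ),
      IsDegeneration ⊤ A P ∧ IsAffineDetRepr (perPoly (Fin n) ℂ) P ∧ IsDegenerationClosed P

/-- **Stub 2 — Jordan–Hölder transport (uniqueness of the polystable model along common degenerations).**  If two square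
matrices of polynomials `A`, `A'` (`det A ≠ 0`) have a COMMON one-parameter degeneration `B`, then any degeneration-closed
degeneration `P` of `A` and any degeneration-closed degeneration `P'` of `A'` are constant-gauge equivalent.  Module-theoretically:
a degeneration is the associated graded of a filtration by subobjects in King's abelian category, so it has the same Jordan–Hölder
composition factors (Schreier refinement); a degeneration-closed object is semisimple (else its own JH graded is a degeneration
outside its orbit); hence `P ≅ ss(A) = ss(B) = ss(A') ≅ P'`.  Invariant-theoretically: `G·P` and `G·P'` are the unique closed
orbits of the good quotient fibres through `A` and `A'`, and `B` lies in both orbit closures.  Size L (hardest stub).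
[cite: King1994, Thm. 4.1] [cite: MumfordFogartyKirwan1994, Ch. 1 §2, Ch. 2 §1] [cite: KempfNess1979] -/
def Stmt.stub_jordanHolder : Prop :=
  ∀ (n m : ℕ) (A A' B P P' : Matrix (Fin m) (Fin m) (MvPolynomial (Fin n × Fin n) ℂ)),
    A.det ≠ 0 →
    IsDegeneration ⊤ A B → IsDegeneration ⊤ A' B →
    IsDegeneration ⊤ A P → IsDegenerationClosed P →
    IsDegeneration ⊤ A' P' → IsDegenerationClosed P' →
    IsDegeneration 0 P P'

/-- Stub 1 — CLOSED BY NAME by the landed helper `Theorems/FreeSubtorusOrbitDimensionBoundStubPolystableModel.lean`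
(val-width-16133-w1 g3; quotient-free Jordan–Hölder existence: stacked block-triangular splits degenerate `A` to a pencil whose
balanced lattice is a finite join of atoms; such a pencil is complemented, and a complemented pencil is degeneration-closed —
the weight-diagonal limit of any of its one-parameter degenerations is a constant gauge form), whose statement is
`Stmt.stub_polystableModel` with `IsDegeneration` / `weightTruncate` / `IsDegenerationClosed` unfolded.
[cite: King1994, Prop. 3.1, Thm. 4.1] -/
theorem stub_polystableModel : Stmt.stub_polystableModel :=
  Summit.ValiantsHypothesis.ValiantsHypothesis.Theorems.FreeSubtorusOrbitDimensionBound.SquareCovering.StableReduction.stub_polystableModel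

/-- Stub 2 — CLOSED BY NAME by the landed helper `Theorems/FreeSubtorusOrbitDimensionBoundStubJordanHolder.lean`
(val-lit-p8 g13, p638570, over `…StubJordanHolderAdaptedBasis` p637752 and `…StubJordanHolderConfluence` p638203:
a common adapted basis for two weight flags, LOCAL CONFLUENCE of one-parameter degenerations of the same square polynomial
matrix, closedness is gauge-invariant; `det A ≠ 0` unused), whose statement is `Stmt.stub_jordanHolder` with
`IsDegeneration` / `weightTruncate` / `IsDegenerationClosed` unfolded. [cite: King1994, Thm. 4.1] -/
theorem stub_jordanHolder : Stmt.stub_jordanHolder :=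
  Summit.ValiantsHypothesis.ValiantsHypothesis.Theorems.FreeSubtorusOrbitDimensionBound.JordanHolder.stub_jordanHolder

/-! ## §2 Composition (kernel-checked, no sorry below this line) -/

/-- **Exact lifts on the polystable model.**  From the two stubs: if the generators `γ ∈ S` lift up to depth-`⊤` degeneration on
`A` (an affine representation of `per_n`), then the polystable model `P` of `A` carries EXACT constant lifts of every `γ ∈ S`
(`γ ⋆ P` is a degeneration-closed degeneration of `γ ⋆ A` by functoriality; JH transport). [cite: King1994, Thm. 4.1] -/
theorem exactLifts_of_model (h₁ : Stmt.stub_polystableModel) (h₂ : Stmt.stub_jordanHolder) {n m : ℕ}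
    {S : Set (GL (Fin n × Fin n) ℂ)} {A : Matrix (Fin m) (Fin m) (MvPolynomial (Fin n × Fin n) ℂ)}
    (hA : IsAffineDetRepr (perPoly (Fin n) ℂ) A) (hL : DepthLifts ⊤ S A) :
    ∃ P : Matrix (Fin m) (Fin m) (MvPolynomial (Fin n × Fin n) ℂ),
      IsAffineDetRepr (perPoly (Fin n) ℂ) P ∧ DepthLifts 0 S P := by
  obtain ⟨P, hAP, hP, hPc⟩ := h₁ n m A hA
  have hdet : A.det ≠ 0 := by rw [hA.2]; exact perPoly_ne_zero (Fin n) ℂ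
  refine ⟨P, hP, fun γ hγ => ?_⟩
  obtain ⟨B, hAB, hγB⟩ := hL γ hγ
  exact ⟨Matrix.linSubstEntries γ P,
    h₂ n m A (Matrix.linSubstEntries γ A) B P (Matrix.linSubstEntries γ P) hdet hAB hγB hAP hPc
      (hAP.linSubstEntries γ) (hPc.linSubstEntries γ),
    IsDegeneration.refl _⟩

/-- **The whole dial from the two stubs**: `PolystableCovering` (`q = ⊤`) — pass to the polystable model (same size `m`, same
`Λ`), which is exactly `T_Λ`-equivariant, and apply the FLOOR `DepthCovering 0 = SubtorusCovering` by name.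
[cite: LandsbergRessayre2017, Thm. 2.8] [cite: King1994, Thm. 4.1] -/
theorem PolystableCovering_of (h₁ : Stmt.stub_polystableModel) (h₂ : Stmt.stub_jordanHolder) : PolystableCovering := by
  intro n hn m r Λ A hΛ hA hL
  obtain ⟨P, hP, hP0⟩ := exactLifts_of_model h₁ h₂ hA hL
  exact depthCovering_zero n hn m r Λ P hΛ hP hP0

/-- Every notch of the dial from the two stubs. [cite: King1994, Thm. 4.1] -/
theorem DepthCovering_of (h₁ : Stmt.stub_polystableModel) (h₂ : Stmt.stub_jordanHolder) (q : ℕ∞) : DepthCovering q :=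
  (PolystableCovering_of h₁ h₂).anti le_top

/-- **The rung, numeric form (`q = 1`), from the two stubs.** [cite: LandsbergRessayre2017, Question 2.2] -/
theorem FilteredCovering_of (h₁ : Stmt.stub_polystableModel) (h₂ : Stmt.stub_jordanHolder) : FilteredCovering :=
  DepthCovering_of h₁ h₂ 1

/-- **The rung (filed declaration `FilteredShadow`) from the two stubs.** [cite: LandsbergRessayre2017, Question 2.2] -/
theorem FilteredShadow_of (h₁ : Stmt.stub_polystableModel) (h₂ : Stmt.stub_jordanHolder) : FilteredShadow :=
  filteredShadow_of_filteredCovering (FilteredCovering_of h₁ h₂)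

/-- Every notch of the shadow dial from the two stubs. [cite: LandsbergRessayre2017, Question 2.2] -/
theorem DepthShadow_of (h₁ : Stmt.stub_polystableModel) (h₂ : Stmt.stub_jordanHolder) (q : ℕ∞) : DepthShadow q :=
  depthShadow_of_depthCovering (DepthCovering_of h₁ h₂ q)

/-- The rung, assembled from the registered stubs (sorries live only inside `stub_*`). [cite: LandsbergRessayre2017, Question 2.2] -/
theorem FilteredShadow_proof : FilteredShadow :=
  FilteredShadow_of stub_polystableModel stub_jordanHolder

/-- … and the RELAXED closing of the host route: symmetrisation up to depth-`1` degeneration + the two stubs ⇒ the summit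
(`closes_filtered` of the ladder). [cite: LandsbergRessayre2017, Question 2.2] -/
theorem summit_of_stubs (h₀ : OrbitDepthBound 1) (h₁ : Stmt.stub_polystableModel) (h₂ : Stmt.stub_jordanHolder) :
    _root_.ValiantsHypothesis :=
  closes_filtered h₀ (FilteredCovering_of h₁ h₂)

/-- The weakest symmetrisation target of the dial also suffices with the two stubs (`q = ⊤`). [cite: King1994, Thm. 4.1] -/
theorem summit_of_stubs_top (h₀ : OrbitDepthBound ⊤) (h₁ : Stmt.stub_polystableModel) (h₂ : Stmt.stub_jordanHolder) :
    _root_.ValiantsHypothesis :=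
  closes_polystable h₀ (PolystableCovering_of h₁ h₂)

end Summit.ValiantsHypothesis.ValiantsHypothesis.Cruxes.OrbitDimensionBound.Depth.Line

/-! ## §3 De-risking lemma for the dictionary (sorry-free): a one-parameter degeneration has BALANCED weight flags

For a square matrix `M` over a domain with the block-triangular zero pattern of `IsDegeneration` (`a i < b j → M i j = 0`) and
`det M ≠ 0`, the columns of weight `≥ k` are supported on the rows of weight `≥ k` and are linearly independent, so
`#{j | k ≤ b j} ≤ #{i | k ≤ a i}` for every level `k`; with `Σ a = Σ b` (determinant preservation) equality holds at every level.
Hence the flags `V_{≥k} = ⟨e_j : b_j ≥ k⟩`, `W_{≥k} = ⟨e_i : a_i ≥ k⟩` have EQUAL dimensions: the degeneration is the associated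
graded of a filtration by equal-dimension sub-pencils — the first step of `stub_jordanHolder` ("Why it might fail (i)" of the card,
discharged). -/

namespace Summit.ValiantsHypothesis.ValiantsHypothesis.Cruxes.OrbitDimensionBound.Depth.Flags

/-- Columns of weight `≥ k` are supported on rows of weight `≥ k` and independent, so there are at most as many of them.
[folklore] -/
theorem card_weight_ge_le {R : Type*} [CommRing R] [IsDomain R] {m : ℕ} (M : Matrix (Fin m) (Fin m) R)
    (a b : Fin m → ℕ) (hzero : ∀ i j, a i < b j → M i j = 0) (hdet : M.det ≠ 0) (k : ℕ) :
    (Finset.univ.filter fun j => k ≤ b j).card ≤ (Finset.univ.filter fun i => k ≤ a i).card := by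
  classical
  set J := {j : Fin m // k ≤ b j}
  set I := {i : Fin m // k ≤ a i}
  -- the restricted columns, as vectors indexed by the heavy rows
  let w : J → (I → R) := fun j i => M i j
  have hcols : LinearIndependent R M.col := linearIndependent_cols_of_det_ne_zero hdet
  have hJ : LinearIndependent R (fun j : J => M.col (j : Fin m)) := hcols.comp _ Subtype.val_injective
  have hw : LinearIndependent R w := by
    rw [Fintype.linearIndependent_iff] at hJ ⊢
    intro g hg j
    apply hJ g
    funext i
    by_cases hi : k ≤ a i
    · have := congr_fun hg ⟨i, hi⟩
      simpa [w, Finset.sum_apply, Pi.smul_apply, Matrix.col] using this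
    · -- light row: every heavy column vanishes there
      simp only [Finset.sum_apply, Pi.smul_apply, Matrix.col_apply, smul_eq_mul, Pi.zero_apply]
      refine Finset.sum_eq_zero fun j _ => ?_
      rw [hzero i j (lt_of_lt_of_le (not_le.mp hi) j.2), mul_zero]
  have hle := hw.fintype_card_le_finrank
  rw [Module.finrank_fintype_fun_eq_card] at hle
  simpa [I, J, Fintype.card_subtype] using hle

/-- Level-by-level domination plus equal total weight forces BALANCED flags. [folklore] -/
theorem card_weight_ge_eq {R : Type*} [CommRing R] [IsDomain R] {m : ℕ} (M : Matrix (Fin m) (Fin m) R)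
    (a b : Fin m → ℕ) (hzero : ∀ i j, a i < b j → M i j = 0) (hdet : M.det ≠ 0)
    (hsum : ∑ i, a i = ∑ j, b j) (k : ℕ) :
    (Finset.univ.filter fun j => k ≤ b j).card = (Finset.univ.filter fun i => k ≤ a i).card := by
  classical
  -- layer-cake: `Σ a = Σ_{k = 1}^{N} #{i | k ≤ a i}` for `N` large
  have cake : ∀ (c : Fin m → ℕ) (N : ℕ), (∀ i, c i ≤ N) →
      ∑ i, c i = ∑ k ∈ Finset.Icc 1 N, (Finset.univ.filter fun i => k ≤ c i).card := by
    intro c N hN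
    simp_rw [Finset.card_filter]
    rw [Finset.sum_comm]
    refine Finset.sum_congr rfl fun i _ => ?_
    rw [Finset.sum_boole]
    have : (Finset.Icc 1 N).filter (fun k => k ≤ c i) = Finset.Icc 1 (c i) := by
      ext k; simp only [Finset.mem_filter, Finset.mem_Icc]; constructor
      · rintro ⟨⟨h1, -⟩, h2⟩; exact ⟨h1, h2⟩
      · rintro ⟨h1, h2⟩; exact ⟨⟨h1, h2.trans (hN i)⟩, h2⟩
    simp [this, Nat.card_Icc]
  obtain ⟨N, hN⟩ : ∃ N, (∀ i, a i ≤ N) ∧ ∀ j, b j ≤ N :=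
    ⟨(Finset.univ.sup a) ⊔ (Finset.univ.sup b),
      fun i => le_sup_of_le_left (Finset.le_sup (Finset.mem_univ i)),
      fun j => le_sup_of_le_right (Finset.le_sup (Finset.mem_univ j))⟩
  have hle : ∀ k, (Finset.univ.filter fun j => k ≤ b j).card ≤ (Finset.univ.filter fun i => k ≤ a i).card :=
    card_weight_ge_le M a b hzero hdet
  rcases Nat.eq_zero_or_pos k with rfl | hk
  · simp
  by_cases hkN : k ≤ N
  · -- equal sums of termwise-dominated families are termwise equal
    have hs : ∑ k ∈ Finset.Icc 1 N, (Finset.univ.filter fun j => k ≤ b j).card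
        = ∑ k ∈ Finset.Icc 1 N, (Finset.univ.filter fun i => k ≤ a i).card := by
      rw [← cake b N hN.2, ← cake a N hN.1, hsum]
    have := (Finset.sum_eq_sum_iff_of_le (fun k _ => hle k)).mp hs k (Finset.mem_Icc.mpr ⟨hk, hkN⟩)
    exact this
  · -- above the top weight both sides are empty
    have hb : (Finset.univ.filter fun j => k ≤ b j) = ∅ :=
      Finset.filter_eq_empty_iff.mpr fun j _ h => hkN ((h.trans (hN.2 j)))
    have ha : (Finset.univ.filter fun i => k ≤ a i) = ∅ :=
      Finset.filter_eq_empty_iff.mpr fun i _ h => hkN ((h.trans (hN.1 i)))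
    rw [hb, ha]

end Summit.ValiantsHypothesis.ValiantsHypothesis.Cruxes.OrbitDimensionBound.Depth.Flags

end
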